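import Summits.NavierStokesRegularity.NavierStokesRegularity.Theses.PerpetualPump
import Literature.Analysis.FluidPDE.TaoCascadeODEProofs
import HarnessLib.Audit

/-!
# Line `declocking-continuation` for crux `PerpetualPump.CircuitPump` (stmt-NavierStokesRegularity-1834)

Skeleton (crux-plan, planner-cruxplan-stmt-NavierStokesRegularity-1834-declocking-continuat-0, 2026-08-16),
from crux idea card `Cruxes/CircuitPump/Ideas/declocking-continuation.md` (ideator 1, round 1; triage r1-1:
PASS with three repairs, all acted on below). POSITIVE line: `circuitPump_of_parts` is the sorry-free
composition `S1 → S2 → S3 → S4 → ⟨crux statement⟩`, and `CircuitPump_of : CircuitPump` (the four sorried stubs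
fed to it) concludes the route decl
`Summit.NavierStokesRegularity.NavierStokesRegularity.Theses.PerpetualPump.CircuitPump` BY NAME — the unique
`#h21_check_skeleton` theorem (closed = false until the stubs land). Stub statements are plain `def … : Prop`
(`stub` tags are gate-stamped, not seat-written).

## The line in one paragraph

Put the crux in its `k = 1` PROFILE FRAME: `X_{i,n}(t) = lam^{-n/5} ψ_i(lam^{4n/5}(−t))` folds all scales
and all `t < 0` into `m` functions on `r > 0` solving the pantograph system `ψ' = ψ − N(ψ)` (`profileN`;
DSS is automatic, Type I is the weight `√r|ψ| ≤ C`), i.e. into the fixed-point problem `ψ = 𝒦N(ψ)`,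
`𝒦 = (1 − d/dr)⁻¹` decaying at `+∞` (`profileK`). In the weighted Banach space `E m = ℝ →ᵇ ℝ^m`
(`φ = √(1+r)ψ`) the operator `T_w = toE ∘ rawT` is completely continuous for EVERY bounded measurable
gating `w` of the coefficients (`CompleteContinuity`), and an exogenous CLOCK is nothing but such a gating:
`w₀ = gate r₂ = 1_{(−∞,r₂]}` evaluated at the BASE scale of each interaction triple (energy conservation
kept). The clocked circuit (`σ = 0`) and the autonomous circuit of the crux (`σ = 1`) are the ends of ONE
compact homotopy `H σ = σT₁ + (1−σ)T_{w₀}` (`homotopyH`). DECLOCKING = Leray–Schauder continuation along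
`σ`: if the clocked pump `φ₀` is the unique, nondegenerate clocked profile in a tube `Ω` (Tao's
transition-state box in profile variables × an amplitude window) and no profile of any intermediate gating
sits on `∂Ω` (the viscous box + the budget identity `½|ψ(0⁺)|² + ∫₀^∞|ψ|² = (1 − lam^{−2/5})Φ̂(ψ)` as
overheating monitor) — stub `DeclockingBox` — then `deg(I − H_σ, Ω) = ind(φ₀) = ±1` for all `σ`
(`LeraySchauderContinuation`, K–Z Thms 20.1/20.6/21.6), so `T₁` has a fixed point `φ₁ ∈ Ω`, `φ₁ ≠ 0`; it
is a `C¹` Type-I profile (`FixedPointIsProfile`) and the PROVED transfer (`profX_hasDerivAt`, `profX_dss`,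
`profX_typeI`) makes it the perpetual pump: lam `= (1+ε₀)^{5/2} < lam₀`, `m = 4`, Tao's Table 1
(`taoCoeffOpt_symm/cyclic`, proved from the tree's `TaoCascade.taoCoeff_symmetric/cancelling`), `k = 1`.

## Registered stubs (4; `def … : Prop` statement + `theorem stub_… : … := by sorry`)

* `FixedPointIsProfile` / `stub_fixedPointIsProfile` (S1, M) — fixed points of `T₁` are `C¹` solutions of
  the profile ODE on `(0,∞)` (FTC for `r ↦ e^r ∫_r^∞ e^{−s} N(ψ)(s) ds`).
* `CompleteContinuity` / `stub_completeContinuity` (S2, M–L; card P1/P2) — `T_w` well defined, continuous,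
  compact on bounded sets, Fréchet-`C¹` with compact derivative, for every measurable `w : ℝ → [0,1]`.
* `LeraySchauderContinuation` / `stub_lerayschauder` (S3, L; Mathlib-only, reusable) — LS continuation from a
  unique nondegenerate solution (Krasnosel'skiĭ–Zabreĭko 1984, Thms 20.1, 20.5, 20.6, 21.1, 21.6; Leray–
  Schauder 1934). Mathlib/tree have no LS degree (tree: Schauder, Brouwer, finite-dim Browder only).
* `DeclockingBox` / `stub_declockingBox` (S4, XL, HARDEST; card K1 + repaired anchor K2, merged as the
  triage recommends) — Tao data in the regime, gate radius `r₂` in the sliver `(r_crit, lam^{4/5}r_crit)`,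
  tube `Ω`, clocked pump `φ₀`: uniqueness + nondegeneracy at `σ = 0`, no boundary fixed points for
  `σ ∈ [0,1]`. Suggested internal cut for the lead (≤ 3 sub-goals, all sharing the tube): (a) DEFINE the
  tube `Ω(K, ε, ε₀, r₂)` (Tao (6.13)–(6.25) in `r`, amplitude window `[A₁,A₂] ∋ A*_aut ≈ 2√2/ε₀,
  A*_I(r₂)`); (b) ANCHOR: the clocked DSS Type-I profile exists, is unique in `cl Ω` and nondegenerate
  (endogenous delay, exogenous isolation — a strengthening of facet `TruncatedDyadicTypeIBlowup`; window
  map `G_I`, fixed amplitude `A*_I = √2/(1 − e^{−(r₂−r_crit)})`, `G_I'(A*_I) ≈ 1 − ε₀²`); (c) VISCOUS BOX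
  for every gating `w_σ`: Prop 6.5 re-run with exact signed damping of relative size `ε₀` (covering-
  threshold's K1, now for all `σ`) + the two amplitude faces (no ignition below; budget identity above).

Proved here (no stub): the transfer S0 (`profX_*`), the coefficient re-encoding, the weight bound
`sqrt_mul_abs_unweight_le`, nontriviality `exists_unweight_ne_zero_of_fixedPoint`, and the whole
composition (homotopy continuity/compactness from S2, LS data plumbing, crux witness). `lean check`: rc 0,
sorries = the 4 stubs; composition axioms standard.

## Disproof / negatives / triage honoured

* `Disproof.lean`: none exists for this crux (payload `disproof_path` absent; `ledger crux ls` 2026-08-16: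
  Ideas ×3 + TRIAGE-r1-1 only) — no `_false_without_` theorem to honour, no landed Negative lemma to check
  stubs against. Refuter exclusions on the item (no steady / pure-power / same-scale / `m = 0` witnesses)
  are respected: the witness is a genuine front, `k = 1`, `m = 4`, `φ₁ ≠ 0` with nonzero residue.
* `ledger negatives --problem NavierStokesRegularity`: 1 entry (stmt-0154, Clay non-uniqueness) — unrelated.
* Triage r1-1 repairs: (1) Mallet-Paret Fredholm theory dropped — `ψ_s = e^s(ψ − N(ψ))` is not
  asymptotically hyperbolic; the line is pure LS degree (S3 needs only compactness + a-priori bounds +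
  the index of ONE nondegenerate point); (2) "K1 = covering's box for every σ" is stated as such (S4(c));
  (3) anchor = ISOLATION gating `(−∞, r₂]` per interaction triple at its base scale, `r₂` in the sliver,
  exogenously TIMED profile (amplitude-attracting, LS index `+1` = index of the autonomous pump in the
  pinned-focal-time frame — no parity obstruction); the gate is `gate r₂`, the triple-consistency is `drop`.
* Regime (triage): `ε₀ → 0`, `K ≥ K₀(ε₀)`, `log(1/ε) ≳ K^{10}/ε₀` (trail amplifiers must not saturate before
  `t = 0`); all existential in S4.
-/

set_option linter.dupNamespace false

noncomputable section

open MeasureTheory Set Filter Topology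
open scoped BoundedContinuousFunction

namespace Summit.NavierStokesRegularity.NavierStokesRegularity.Cruxes.CircuitPump.DeclockingContinuation

/-! ## The profile (pantograph) frame -/

/-- Relative scale offset of the FIRST input slot for an offset label `μ ∈ Option (Fin 3)`
(`none = (0,0,0)`, `some j = e_{j+1}` of Tao's shift set `S`): exactly the crux's
`(if μ = some 0 then 1 else 0) - (if μ = some 2 then 1 else 0)`. -/
def off₁ (μ : Option (Fin 3)) : ℤ := (if μ = some 0 then 1 else 0) - (if μ = some 2 then 1 else 0)

/-- Relative scale offset of the SECOND input slot (crux: `[μ = some 1] - [μ = some 2]`). -/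
def off₂ (μ : Option (Fin 3)) : ℤ := (if μ = some 1 then 1 else 0) - (if μ = some 2 then 1 else 0)

/-- Base-scale drop `[μ = some 2]` of a monomial (crux: the exponent `lam ^ (n - [μ = some 2])`); the base
scale `n - drop μ` is the same for the three cyclically related monomials of one interaction triple, which
is why the clock below gates a triple by the window evaluated at its BASE scale (energy conservation of
the gated system is kept). -/
def drop (μ : Option (Fin 3)) : ℝ := if μ = some 2 then 1 else 0

/-- The GATED PROFILE NONLINEARITY (pantograph form of the crux's circuit class (4.3) under the `k = 1`
ansatz `X_{i,n}(t) = lam^{-n/5} ψ_i(lam^{4n/5}(-t))`, `r = lam^{4n/5}|t| > 0`):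
`N_w(ψ)_i(r) = Σ_{i₁ i₂ μ} coeff(i₁,i₂,i,μ) · w(lam^{-(4/5)·drop μ} r) · lam^{-(drop μ + (off₁ μ + off₂ μ)/5)}
  · ψ_{i₁}(lam^{(4/5) off₁ μ} r) · ψ_{i₂}(lam^{(4/5) off₂ μ} r)`.
`w ≡ 1` is the autonomous circuit; `w = gate r₂` is the clocked (isolation-gated) circuit. -/
def profileN (lam : ℝ) {m : ℕ} (coeff : Fin m → Fin m → Fin m → Option (Fin 3) → ℝ) (w : ℝ → ℝ)
    (ψ : Fin m → ℝ → ℝ) (i : Fin m) (r : ℝ) : ℝ :=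
  ∑ i₁ : Fin m, ∑ i₂ : Fin m, ∑ μ : Option (Fin 3),
    coeff i₁ i₂ i μ * w (lam ^ (-((4 / 5 : ℝ) * drop μ)) * r) *
      lam ^ (-(drop μ + ((off₁ μ : ℝ) + (off₂ μ : ℝ)) / 5)) *
      ψ i₁ (lam ^ ((4 / 5 : ℝ) * (off₁ μ : ℝ)) * r) * ψ i₂ (lam ^ ((4 / 5 : ℝ) * (off₂ μ : ℝ)) * r)

/-- The resolvent `𝒦 = (1 - d/dr)⁻¹` decaying at `r = +∞`: `(𝒦 f)(r) = ∫_{s > r} e^{r-s} f(s) ds`.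
A Type-I-bounded profile solution of `ψ' = ψ - N(ψ)` is exactly a fixed point `ψ = 𝒦 N(ψ)`. -/
def profileK (f : ℝ → ℝ) (r : ℝ) : ℝ := ∫ s in Set.Ioi r, Real.exp (r - s) * f s

/-- The Banach space of the Leray–Schauder frame: bounded continuous `φ : ℝ → ℝ^m` (sup norm). An element
represents the WEIGHTED profile `φ(r) = √(1+r)·ψ(r)` on `r ≥ 0` (values at `r < 0` are slaved to `r = 0` by
the operator), so `‖φ‖ < ∞` contains the Type-I bound `√r |ψ(r)| ≤ C`. -/
abbrev E (m : ℕ) := BoundedContinuousFunction ℝ (Fin m → ℝ)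

/-- The Type-I weight `√(1+r)`. -/
def wt (r : ℝ) : ℝ := Real.sqrt (1 + r)

/-- The profile `ψ = φ / √(1+r)` represented by `φ ∈ E m`. -/
def unweight {m : ℕ} (φ : E m) (i : Fin m) (r : ℝ) : ℝ := φ r i / wt r

/-- The raw (function-level) image of `φ` under the weighted fixed-point operator:
`r ↦ √(1+r⁺) · 𝒦 N_w(φ/wt)_i (r⁺)`, `r⁺ = max r 0`. -/
def rawT (lam : ℝ) {m : ℕ} (coeff : Fin m → Fin m → Fin m → Option (Fin 3) → ℝ) (w : ℝ → ℝ)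
    (φ : E m) : ℝ → Fin m → ℝ :=
  fun r i => wt (max r 0) * profileK (profileN lam coeff w (unweight φ) i) (max r 0)

/-- Re-read a raw function as an element of `E m` when it is one (else `0`; `CompleteContinuity` asserts
the first branch always applies to `rawT`). -/
def toE {m : ℕ} (g : ℝ → Fin m → ℝ) : E m := by
  classical exact if h : ∃ f : E m, (f : ℝ → Fin m → ℝ) = g then h.choose else 0

/-- THE OPERATOR `T_w : E m → E m`, `T_w φ = √(1+r⁺)·𝒦 N_w(φ/√(1+·))(r⁺)`; its fixed points are the
Type-I-bounded DSS (`k = 1`) profiles of the `w`-gated circuit. -/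
def opT (lam : ℝ) {m : ℕ} (coeff : Fin m → Fin m → Fin m → Option (Fin 3) → ℝ) (w : ℝ → ℝ)
    (φ : E m) : E m :=
  toE (rawT lam coeff w φ)

/-- The CLOCK: isolation gating `w₀ = 1_{(−∞, r₂]}` (a triple with base scale `n_b` is switched on once
`r_{n_b} = lam^{4n_b/5}|t| ≤ r₂`, i.e. scale `n_b`'s pump/amplifier/rotor and its drain to `n_b + 1` open
together and stay open; finer scales are still closed). -/
def gate (r₂ : ℝ) (r : ℝ) : ℝ := if r ≤ r₂ then 1 else 0

/-- Tao's offset labels as points of the tree's shift set `S ⊂ ℤ³` (`TaoCascade.shiftSet`). -/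
def optShift (μ : Option (Fin 3)) : ℤ × ℤ × ℤ :=
  ((if μ = some 0 then 1 else 0), (if μ = some 1 then 1 else 0), (if μ = some 2 then 1 else 0))

/-- TAO'S TABLE-1 STRUCTURE CONSTANTS (`m = 4`; tree `TaoCascade.taoCoeff`, with the tree's correction of
the two misprinted entries) in the crux's `Option (Fin 3)` encoding. -/
def taoCoeffOpt (ε₀ K ε : ℝ) (a b c : Fin 4) (μ : Option (Fin 3)) : ℝ :=
  Literature.Analysis.FluidPDE.TaoCascade.taoCoeff ε₀ K ε a b c (optShift μ)

/-- Tao's fine scale ratio `lam = (1+ε₀)^{5/2}` (`lam^{4/5} = (1+ε₀)²` is the dissipation ratio). -/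
def taoLam (ε₀ : ℝ) : ℝ := (1 + ε₀) ^ ((5 : ℝ) / 2)

/-- THE DECLOCKING HOMOTOPY `H σ = σ·T₁ + (1-σ)·T_{gate r₂}` (`= T_{w_σ}` for `w_σ = σ + (1-σ)·gate r₂`, as
`N_w` is linear in `w`): `σ = 0` clocked anchor, `σ = 1` the autonomous circuit of the crux. -/
def homotopyH (lam : ℝ) (coeff : Fin 4 → Fin 4 → Fin 4 → Option (Fin 3) → ℝ) (r₂ : ℝ) (σ : ℝ)
    (φ : E 4) : E 4 :=
  σ • opT lam coeff (fun _ => (1 : ℝ)) φ + (1 - σ) • opT lam coeff (gate r₂) φ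

/-! ## The four registered stubs (statements as named `Prop`s; the `stub_*` bodies are `sorry`) -/

/-- **S1 — FIXED POINTS ARE PROFILE SOLUTIONS (frame regularity).** For the autonomous gating `w ≡ 1`, a fixed
point `T_1 φ = φ` represents a profile `ψ = φ/√(1+r)` which is `C¹` on `(0,∞)` and solves
`ψ_i'(r) = ψ_i(r) − N_1(ψ)_i(r)` there (differentiate `r ↦ e^{r}∫_r^∞ e^{-s}N(ψ)(s)ds`; `N(ψ)` is continuous
and `O(1/(1+s))`). Size M. -/
def FixedPointIsProfile : Prop :=
  ∀ (lam : ℝ), 1 < lam → ∀ (m : ℕ) (coeff : Fin m → Fin m → Fin m → Option (Fin 3) → ℝ) (φ : E m),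
    opT lam coeff (fun _ => (1 : ℝ)) φ = φ →
    ∀ (i : Fin m) (r : ℝ), 0 < r →
      HasDerivAt (unweight φ i) (unweight φ i r - profileN lam coeff (fun _ => (1 : ℝ)) (unweight φ) i r) r

/-- **S2 — COMPLETE CONTINUITY OF THE FRAME (card P1/P2 territory).** For every bounded measurable gating
`w : ℝ → [0,1]`: (a) `T_w` is well defined on `E m` (the raw image `√(1+r⁺)𝒦N_w(φ/wt)(r⁺)` is bounded and
continuous: `|N_w ψ(s)| ≲ ‖φ‖²/(1+s)`, `|𝒦N_w ψ(r)| ≲ ‖φ‖²/(1+r)`); (b) `T_w` is continuous (locally Lipschitz,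
`N` quadratic); (c) `T_w` maps bounded sets to relatively compact sets (uniformly Lipschitz images, decay
`‖φ‖²/√(1+r)` at `+∞`, constancy on `r ≤ 0`: Arzelà–Ascoli); (d) `T_w` is Fréchet differentiable with a COMPACT
derivative (the linearised pantograph operator `h ↦ √(1+r)𝒦[2B_w(ψ,h/wt)]`). Size M–L. -/
def CompleteContinuity : Prop :=
  ∀ (lam : ℝ), 1 < lam → ∀ (m : ℕ) (coeff : Fin m → Fin m → Fin m → Option (Fin 3) → ℝ) (w : ℝ → ℝ),
    Measurable w → (∀ r, w r ∈ Set.Icc (0 : ℝ) 1) →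
    (∀ φ : E m, ∃ f : E m, (f : ℝ → Fin m → ℝ) = rawT lam coeff w φ) ∧
    Continuous (opT lam coeff w : E m → E m) ∧
    (∀ S : Set (E m), Bornology.IsBounded S → IsCompact (closure (opT lam coeff w '' S))) ∧
    (∀ φ : E m, ∃ L : E m →L[ℝ] E m, HasFDerivAt (opT lam coeff w) L φ ∧ IsCompactOperator L)

/-- **S3 — LERAY–SCHAUDER CONTINUATION FROM A UNIQUE NONDEGENERATE SOLUTION (abstract, Mathlib-only).**
In a real Banach space: a compact homotopy `H : [0,1] × cl Ω → V` (Ω open bounded) without fixed points on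
`[0,1] × ∂Ω`, whose start `H₀` has exactly one fixed point `x₀` in `cl Ω`, Fréchet-nondegenerate
(`H₀` differentiable at `x₀` with compact derivative `L`, `I − L` injective), has a fixed point of `H₁` in `Ω`.
(= LS degree: `deg(I−H_σ, Ω)` is constant (K–Z Thm 20.1), equals `ind(x₀) = (−1)^β ≠ 0` at `σ = 0`
(Thms 20.6, 21.6), hence `H₁` has a fixed point (Thm 20.5).) Not in Mathlib/tree (only Schauder's theorem is:
`Literature.Analysis.Convex.exists_fixedPoint_of_isCompact_closure`). Size L. -/
def LeraySchauderContinuation : Prop :=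
  ∀ (V : Type) [NormedAddCommGroup V] [NormedSpace ℝ V] [CompleteSpace V]
    (Ω : Set V) (H : ℝ → V → V) (x₀ : V) (L : V →L[ℝ] V),
    IsOpen Ω → Bornology.IsBounded Ω →
    ContinuousOn (fun p : ℝ × V => H p.1 p.2) (Set.Icc (0 : ℝ) 1 ×ˢ closure Ω) →
    IsCompact (closure ((fun p : ℝ × V => H p.1 p.2) '' (Set.Icc (0 : ℝ) 1 ×ˢ closure Ω))) →
    (∀ σ ∈ Set.Icc (0 : ℝ) 1, ∀ x ∈ frontier Ω, H σ x ≠ x) →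
    x₀ ∈ Ω → H 0 x₀ = x₀ → (∀ x ∈ closure Ω, H 0 x = x → x = x₀) →
    HasFDerivAt (H 0) L x₀ → IsCompactOperator L → Function.Injective (fun v => v - L v) →
    ∃ x ∈ Ω, H 1 x = x

/-- **S4 — THE DECLOCKING BOX (hardest; card K1 + repaired anchor K2, merged per triage).** For every `lam₀ > 1`
there are Tao parameters `ε₀ > 0` (with `lam = (1+ε₀)^{5/2} < lam₀`), `K`, `ε` (regime `K ≥ K₀(ε₀)`,
`log(1/ε) ≳ K^{10}/ε₀`), a gate radius `r₂` in the sliver `(r_crit, lam^{4/5} r_crit)`,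
`r_crit = [(1/5)log lam + ½log(1−leak)]/(lam^{4/5}−1) ≈ 1/4`, an open bounded TUBE `Ω ⊂ E 4` not
accumulating at `0` (Tao's transition-state box (6.13)–(6.25) in profile variables × an amplitude window
`[A₁, A₂] ∋ A*_aut, A*_I(r₂)`), and a clocked profile `φ₀ ∈ Ω` such that: `T_{gate r₂} φ₀ = φ₀`; `φ₀` is the
ONLY clocked fixed point in `cl Ω` (exogenously timed pump waiting at the gate, window map
`G_I(A) = lam^{1/5}(1−leak)^{1/2}e^{−(lam^{4/5}−1)r₂}A(1−√2/A)^{−(lam^{4/5}−1)}`, `A*_I = √2/(1−e^{−(r₂−r_crit)})`);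
it is NONDEGENERATE (`G_I'(A*_I) ≈ 1 − ε₀² ≠ 1`; no gauge mode in the pinned-focal-time frame); and along the
declocking homotopy `σ ∈ [0,1]` NO fixed point lies on `∂Ω` (the viscous box: Prop 6.5 re-run with exact
signed damping of relative size `ε₀` for every gating `w_σ`, plus the two amplitude faces, which are never
solutions: below by no-ignition, above by the budget identity
`½|ψ(0⁺)|² + ∫₀^∞|ψ|² = (1 − lam^{−2/5})Φ̂(ψ)` — a profile hotter than the window would have to leak the whole
budget inviscidly, impossible for a circuit whose inviscid leak is `≤ K^{−20} + O(ε²)`). Size XL. -/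
def DeclockingBox : Prop :=
  ∀ lam₀ : ℝ, 1 < lam₀ → ∃ ε₀ K ε r₂ : ℝ, 0 < ε₀ ∧ taoLam ε₀ < lam₀ ∧ 0 < r₂ ∧
    ∃ (Ω : Set (E 4)) (φ₀ : E 4),
      IsOpen Ω ∧ Bornology.IsBounded Ω ∧ (0 : E 4) ∉ closure Ω ∧ φ₀ ∈ Ω ∧
      opT (taoLam ε₀) (taoCoeffOpt ε₀ K ε) (gate r₂) φ₀ = φ₀ ∧
      (∀ φ ∈ closure Ω, opT (taoLam ε₀) (taoCoeffOpt ε₀ K ε) (gate r₂) φ = φ → φ = φ₀) ∧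
      (∀ L : E 4 →L[ℝ] E 4, HasFDerivAt (opT (taoLam ε₀) (taoCoeffOpt ε₀ K ε) (gate r₂)) L φ₀ →
        Function.Injective (fun h => h - L h)) ∧
      (∀ σ ∈ Set.Icc (0 : ℝ) 1, ∀ φ ∈ frontier Ω, homotopyH (taoLam ε₀) (taoCoeffOpt ε₀ K ε) r₂ σ φ ≠ φ)

theorem stub_fixedPointIsProfile : FixedPointIsProfile := by
  sorry

theorem stub_completeContinuity : CompleteContinuity := by
  sorry

theorem stub_lerayschauder : LeraySchauderContinuation := by
  sorry

theorem stub_declockingBox : DeclockingBox := by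
  sorry

/-! ## Proved glue: coefficient re-encoding, the weight bound, nontriviality -/

/-- The six permutations of `Fin 3`, for sums over `Equiv.Perm (Fin 3)`. [folklore] -/
theorem sum_perm_fin_three {M : Type*} [AddCommMonoid M] (g : Equiv.Perm (Fin 3) → M) :
    ∑ σ : Equiv.Perm (Fin 3), g σ =
      g 1 + g (Equiv.swap 0 1) + g (Equiv.swap 0 2) + g (Equiv.swap 1 2) +
        g (Equiv.swap 0 1 * Equiv.swap 1 2) + g (Equiv.swap 1 2 * Equiv.swap 0 1) := by
  have h : (Finset.univ : Finset (Equiv.Perm (Fin 3))) =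
      {1, Equiv.swap 0 1, Equiv.swap 0 2, Equiv.swap 1 2, Equiv.swap 0 1 * Equiv.swap 1 2,
        Equiv.swap 1 2 * Equiv.swap 0 1} := by decide
  rw [h]
  rw [Finset.sum_insert (by decide), Finset.sum_insert (by decide), Finset.sum_insert (by decide),
    Finset.sum_insert (by decide), Finset.sum_insert (by decide), Finset.sum_singleton]
  abel

open Literature.Analysis.FluidPDE TaoCascade in
/-- Tao's Table 1 obeys the crux's symmetry clause (4.2) in the `Option (Fin 3)` encoding
(from the tree's `TaoCascade.taoCoeff_symmetric`). -/
theorem taoCoeffOpt_symm (ε₀ K ε : ℝ) (i₁ i₂ i₃ : Fin 4) (μ : Option (Fin 3)) :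
    taoCoeffOpt ε₀ K ε i₁ i₂ i₃ μ =
      taoCoeffOpt ε₀ K ε i₂ i₁ i₃ (Option.map (Equiv.swap (0 : Fin 3) 1) μ) := by
  have hS := taoCoeff_symmetric ε₀ K ε
  rcases μ with _ | j
  · simpa [taoCoeffOpt, optShift] using hS i₁ i₂ i₃ 0 0 0 (by simp [mem_shiftSet_iff])
  · fin_cases j
    · simpa [taoCoeffOpt, optShift] using hS i₁ i₂ i₃ 1 0 0 (by simp [mem_shiftSet_iff])
    · simpa [taoCoeffOpt, optShift] using hS i₁ i₂ i₃ 0 1 0 (by simp [mem_shiftSet_iff])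
    · simpa [taoCoeffOpt, optShift, Equiv.swap_apply_of_ne_of_ne] using
        hS i₁ i₂ i₃ 0 0 1 (by simp [mem_shiftSet_iff])

open Literature.Analysis.FluidPDE TaoCascade in
/-- Tao's Table 1 obeys the crux's cyclic-cancellation clause (4.3) in the `Option (Fin 3)` encoding
(from the tree's `TaoCascade.taoCoeff_cancelling`; the permutation `σ` relabels the slots and moves the
raised slot to `σ⁻¹ j`). -/
theorem taoCoeffOpt_cyclic (ε₀ K ε : ℝ) (v : Fin 3 → Fin 4) (μ : Option (Fin 3)) :
    ∑ σ : Equiv.Perm (Fin 3),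
      taoCoeffOpt ε₀ K ε (v (σ 0)) (v (σ 1)) (v (σ 2)) (Option.map σ.symm μ) = 0 := by
  have hC := taoCoeff_cancelling ε₀ K ε
  have hc1 : (Equiv.swap (0 : Fin 3) 1 * Equiv.swap 1 2).symm = Equiv.swap 1 2 * Equiv.swap 0 1 := by
    decide
  have hc2 : (Equiv.swap (1 : Fin 3) 2 * Equiv.swap 0 1).symm = Equiv.swap 0 1 * Equiv.swap 1 2 := by
    decide
  have h1 : (1 : Equiv.Perm (Fin 3)).symm = 1 := by decide
  rw [sum_perm_fin_three]
  rcases μ with _ | j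
  · have := hC (v 0) (v 1) (v 2) 0 0 0 (by simp [mem_shiftSet_iff])
    simp [taoCoeffOpt, optShift, Equiv.Perm.mul_apply, Equiv.swap_apply_of_ne_of_ne,
      Equiv.swap_apply_left, Equiv.swap_apply_right] at this ⊢
    linear_combination this
  · fin_cases j
    · have := hC (v 0) (v 1) (v 2) 1 0 0 (by simp [mem_shiftSet_iff])
      simp [taoCoeffOpt, optShift, Equiv.Perm.mul_apply, Equiv.swap_apply_of_ne_of_ne,
        Equiv.swap_apply_left, Equiv.swap_apply_right, Equiv.symm_swap, hc1, hc2, h1] at this ⊢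
      linear_combination this
    · have := hC (v 0) (v 1) (v 2) 0 1 0 (by simp [mem_shiftSet_iff])
      simp [taoCoeffOpt, optShift, Equiv.Perm.mul_apply, Equiv.swap_apply_of_ne_of_ne,
        Equiv.swap_apply_left, Equiv.swap_apply_right, Equiv.symm_swap, hc1, hc2, h1] at this ⊢
      linear_combination this
    · have := hC (v 0) (v 1) (v 2) 0 0 1 (by simp [mem_shiftSet_iff])
      simp [taoCoeffOpt, optShift, Equiv.Perm.mul_apply, Equiv.swap_apply_of_ne_of_ne,
        Equiv.swap_apply_left, Equiv.swap_apply_right, Equiv.symm_swap, hc1, hc2, h1] at this ⊢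
      linear_combination this

/-- `lam = (1+ε₀)^{5/2} > 1` for `ε₀ > 0`. -/
theorem one_lt_taoLam {ε₀ : ℝ} (h : 0 < ε₀) : 1 < taoLam ε₀ :=
  Real.one_lt_rpow (by linarith) (by norm_num)

/-- The gate is measurable. -/
theorem measurable_gate (r₂ : ℝ) : Measurable (gate r₂) := by
  unfold gate
  exact Measurable.ite measurableSet_Iic measurable_const measurable_const

/-- The gate takes values in `[0,1]`. -/
theorem gate_mem_Icc (r₂ r : ℝ) : gate r₂ r ∈ Set.Icc (0 : ℝ) 1 := by
  unfold gate
  split_ifs <;> simp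

theorem toE_spec {m : ℕ} {g : ℝ → Fin m → ℝ} (h : ∃ f : E m, (f : ℝ → Fin m → ℝ) = g) :
    ((toE g : E m) : ℝ → Fin m → ℝ) = g := by
  classical
  unfold toE
  rw [dif_pos h]
  exact h.choose_spec

theorem toE_of_not {m : ℕ} {g : ℝ → Fin m → ℝ} (h : ¬ ∃ f : E m, (f : ℝ → Fin m → ℝ) = g) :
    (toE g : E m) = 0 := by
  classical
  unfold toE
  rw [dif_neg h]

/-- The Type-I weight is built into the frame: `√r |ψ_i(r)| ≤ ‖φ‖` for `ψ = φ/√(1+r)`. -/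
theorem sqrt_mul_abs_unweight_le {m : ℕ} (φ : E m) (i : Fin m) (r : ℝ) (hr : 0 < r) :
    Real.sqrt r * |unweight φ i r| ≤ ‖φ‖ := by
  have hw : 0 < wt r := Real.sqrt_pos.2 (by linarith)
  have h1 : |φ r i| ≤ ‖φ‖ := by
    calc |φ r i| = ‖φ r i‖ := (Real.norm_eq_abs _).symm
      _ ≤ ‖φ r‖ := norm_le_pi_norm (φ r) i
      _ ≤ ‖φ‖ := BoundedContinuousFunction.norm_coe_le_norm φ r
  have h2 : Real.sqrt r ≤ wt r := Real.sqrt_le_sqrt (by linarith)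
  rw [unweight, abs_div, abs_of_pos hw]
  calc Real.sqrt r * (|φ r i| / wt r) = (Real.sqrt r / wt r) * |φ r i| := by ring
    _ ≤ 1 * ‖φ‖ := by
        apply mul_le_mul _ h1 (abs_nonneg _) zero_le_one
        rwa [div_le_one hw]
    _ = ‖φ‖ := one_mul _

/-- A nonzero `φ ∈ E m` whose values are a function of `max r 0` (true of every fixed point of `T_w`)
represents a profile that is nonzero somewhere on `(0,∞)` (continuity at `0⁺`). -/
theorem exists_unweight_ne_zero {m : ℕ} (φ : E m) (G : ℝ → Fin m → ℝ)
    (hG : ∀ r, φ r = G (max r 0)) (hφ : φ ≠ 0) :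
    ∃ (i : Fin m) (r : ℝ), 0 < r ∧ unweight φ i r ≠ 0 := by
  by_contra hcon
  push Not at hcon
  apply hφ
  have hpos : ∀ (i : Fin m) (r : ℝ), 0 < r → φ r i = 0 := by
    intro i r hr
    have h := hcon i r hr
    have hw : 0 < wt r := Real.sqrt_pos.2 (by linarith)
    rw [unweight, div_eq_zero_iff] at h
    rcases h with h | h
    · exact h
    · exact absurd h hw.ne'
  have hzero : ∀ i : Fin m, φ 0 i = 0 := by
    intro i
    have hc : Continuous fun r : ℝ => φ r i := (continuous_apply i).comp φ.continuous
    have ht : Tendsto (fun r : ℝ => φ r i) (𝓝[>] 0) (𝓝 (φ 0 i)) :=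
      hc.continuousAt.tendsto.mono_left nhdsWithin_le_nhds
    have ht0 : Tendsto (fun r : ℝ => φ r i) (𝓝[>] 0) (𝓝 0) := by
      apply tendsto_const_nhds.congr'
      filter_upwards [self_mem_nhdsWithin] with r hr
      exact (hpos i r hr).symm
    exact tendsto_nhds_unique ht ht0
  ext r i
  simp only [BoundedContinuousFunction.coe_zero, Pi.zero_apply]
  rcases lt_or_ge 0 r with hr | hr
  · exact hpos i r hr
  · have : φ r = φ 0 := by rw [hG r, hG 0, max_eq_right hr, max_self]
    rw [this]
    exact hzero i

/-- A fixed point of `T_w` is slaved to `r = 0` on `r ≤ 0`; if nonzero, its profile is nontrivial on `(0,∞)`. -/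
theorem exists_unweight_ne_zero_of_fixedPoint {m : ℕ} (lam : ℝ)
    (coeff : Fin m → Fin m → Fin m → Option (Fin 3) → ℝ) (w : ℝ → ℝ) (φ : E m)
    (hfix : opT lam coeff w φ = φ) (hφ : φ ≠ 0) :
    ∃ (i : Fin m) (r : ℝ), 0 < r ∧ unweight φ i r ≠ 0 := by
  classical
  by_cases h : ∃ f : E m, (f : ℝ → Fin m → ℝ) = rawT lam coeff w φ
  · have hco : (φ : ℝ → Fin m → ℝ) = rawT lam coeff w φ := by
      have := toE_spec h
      rwa [show toE (rawT lam coeff w φ) = φ from hfix] at this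
    refine exists_unweight_ne_zero φ
      (fun ρ i => wt ρ * profileK (profileN lam coeff w (unweight φ) i) ρ) (fun r => ?_) hφ
    funext i
    have := congrFun (congrFun hco r) i
    simpa [rawT] using this
  · exact absurd ((toE_of_not h).symm.trans hfix).symm hφ

/-! ## Proved: the TRANSFER profile ⇒ lattice (the card's `circuitPump_of_profile`, no longer a stub) -/

/-- The lattice field built from a `k = 1` profile: `X_{i,n}(t) = lam^{-n/5} ψ_i(lam^{4n/5}(−t))`. -/
def profX (lam : ℝ) {m : ℕ} (ψ : Fin m → ℝ → ℝ) : Fin m → ℤ → ℝ → ℝ :=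
  fun i n t => lam ^ (-((1 / 5 : ℝ) * n)) * ψ i (lam ^ ((4 / 5 : ℝ) * n) * (-t))

section Transfer
variable {lam : ℝ} (hlam : 1 < lam) {m : ℕ}

include hlam

/-- `profX` is exactly discretely self-similar with period `k = 1`. -/
theorem profX_dss (ψ : Fin m → ℝ → ℝ) (i : Fin m) (n : ℤ) (t : ℝ) :
    profX lam ψ i (n + 1) (lam ^ (-(4 / 5 : ℝ)) * t) = lam ^ (-(1 / 5 : ℝ)) * profX lam ψ i n t := by
  have hpos : 0 < lam := by linarith
  simp only [profX]
  have h1 : lam ^ ((4 / 5 : ℝ) * ((n + 1 : ℤ) : ℝ)) * (-(lam ^ (-(4 / 5 : ℝ)) * t)) =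
      lam ^ ((4 / 5 : ℝ) * (n : ℝ)) * (-t) := by
    push_cast
    have : lam ^ ((4 / 5 : ℝ) * ((n : ℝ) + 1)) * lam ^ (-(4 / 5 : ℝ)) =
        lam ^ ((4 / 5 : ℝ) * (n : ℝ)) := by
      rw [← Real.rpow_add hpos]; congr 1; ring
    calc lam ^ ((4 / 5 : ℝ) * ((n : ℝ) + 1)) * (-(lam ^ (-(4 / 5 : ℝ)) * t))
        = -(lam ^ ((4 / 5 : ℝ) * ((n : ℝ) + 1)) * lam ^ (-(4 / 5 : ℝ))) * t := by ring
      _ = lam ^ ((4 / 5 : ℝ) * (n : ℝ)) * (-t) := by rw [this]; ring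
  have h2 : lam ^ (-((1 / 5 : ℝ) * ((n + 1 : ℤ) : ℝ))) =
      lam ^ (-(1 / 5 : ℝ)) * lam ^ (-((1 / 5 : ℝ) * (n : ℝ))) := by
    push_cast
    rw [← Real.rpow_add hpos]; congr 1; ring
  rw [h1, h2]
  ring

/-- The Type-I weight transfers: `√r|ψ| ≤ C` gives `lam^{3n/5}|X_{i,n}(t)| ≤ C/√(−t)`. -/
theorem profX_typeI (ψ : Fin m → ℝ → ℝ) {C : ℝ}
    (hbd : ∀ (i : Fin m) (r : ℝ), 0 < r → Real.sqrt r * |ψ i r| ≤ C)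
    (i : Fin m) (n : ℤ) (t : ℝ) (ht : t < 0) :
    lam ^ ((3 / 5 : ℝ) * n) * |profX lam ψ i n t| ≤ C / Real.sqrt (-t) := by
  have hpos : 0 < lam := by linarith
  have hnt : 0 < -t := by linarith
  set r : ℝ := lam ^ ((4 / 5 : ℝ) * n) * (-t) with hr
  have hrpos : 0 < r := mul_pos (Real.rpow_pos_of_pos hpos _) hnt
  have hsq : Real.sqrt r = lam ^ ((2 / 5 : ℝ) * n) * Real.sqrt (-t) := by
    rw [hr, Real.sqrt_mul (Real.rpow_nonneg hpos.le _), Real.sqrt_eq_rpow, ← Real.rpow_mul hpos.le]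
    congr 2; ring
  have key := hbd i r hrpos
  rw [hsq] at key
  have hX : lam ^ ((3 / 5 : ℝ) * n) * |profX lam ψ i n t| = lam ^ ((2 / 5 : ℝ) * n) * |ψ i r| := by
    simp only [profX]
    rw [abs_mul, abs_of_pos (Real.rpow_pos_of_pos hpos _), ← mul_assoc, ← Real.rpow_add hpos]
    congr 2; ring
  rw [hX, le_div_iff₀ (Real.sqrt_pos.2 hnt)]
  calc lam ^ ((2 / 5 : ℝ) * n) * |ψ i r| * Real.sqrt (-t)
      = lam ^ ((2 / 5 : ℝ) * n) * Real.sqrt (-t) * |ψ i r| := by ring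
    _ ≤ C := key

/-- The profile ODE transfers to the crux's circuit ODE (chain rule + scale bookkeeping): for `t < 0`,
`Ẋ_{i,n}(t) = −lam^{4n/5}X_{i,n} + Σ coeff·lam^{n−[μ=e₃]}·X_{i₁,n+off₁}X_{i₂,n+off₂}` — literally the
crux's `F`. -/
theorem profX_hasDerivAt (coeff : Fin m → Fin m → Fin m → Option (Fin 3) → ℝ) (ψ : Fin m → ℝ → ℝ)
    (hψ : ∀ (i : Fin m) (r : ℝ), 0 < r →
      HasDerivAt (ψ i) (ψ i r - profileN lam coeff (fun _ => (1 : ℝ)) ψ i r) r)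
    (i : Fin m) (n : ℤ) (t : ℝ) (ht : t < 0) :
    HasDerivAt (profX lam ψ i n)
      (-(lam ^ ((4 / 5 : ℝ) * n)) * profX lam ψ i n t +
        ∑ i₁ : Fin m, ∑ i₂ : Fin m, ∑ μ : Option (Fin 3),
          coeff i₁ i₂ i μ * lam ^ ((n : ℝ) - (if μ = some 2 then 1 else 0)) *
            profX lam ψ i₁ (n + ((if μ = some 0 then 1 else 0) - (if μ = some 2 then 1 else 0))) t *
            profX lam ψ i₂ (n + ((if μ = some 1 then 1 else 0) - (if μ = some 2 then 1 else 0))) t) t := by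
  have hpos : 0 < lam := by linarith
  have hnt : 0 < -t := by linarith
  set r : ℝ := lam ^ ((4 / 5 : ℝ) * n) * (-t) with hr
  have hrpos : 0 < r := mul_pos (Real.rpow_pos_of_pos hpos _) hnt
  -- chain rule
  have hinner : HasDerivAt (fun s : ℝ => lam ^ ((4 / 5 : ℝ) * n) * (-s)) (-(lam ^ ((4 / 5 : ℝ) * n))) t := by
    simpa using ((hasDerivAt_neg t).const_mul (lam ^ ((4 / 5 : ℝ) * n)))
  have hcomp : HasDerivAt (ψ i ∘ fun s : ℝ => lam ^ ((4 / 5 : ℝ) * n) * (-s))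
      ((ψ i r - profileN lam coeff (fun _ => (1 : ℝ)) ψ i r) * (-(lam ^ ((4 / 5 : ℝ) * n)))) t :=
    (hψ i r hrpos).comp t hinner
  have hD : HasDerivAt (profX lam ψ i n)
      (lam ^ (-((1 / 5 : ℝ) * n)) *
        ((ψ i r - profileN lam coeff (fun _ => (1 : ℝ)) ψ i r) * (-(lam ^ ((4 / 5 : ℝ) * n))))) t :=
    hcomp.const_mul (lam ^ (-((1 / 5 : ℝ) * n)))
  refine hD.congr_deriv ?_
  -- scale bookkeeping
  have harg : ∀ k : ℤ, lam ^ ((4 / 5 : ℝ) * ((n + k : ℤ) : ℝ)) * (-t) =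
      lam ^ ((4 / 5 : ℝ) * (k : ℝ)) * r := by
    intro k
    rw [hr]
    push_cast
    rw [mul_add, Real.rpow_add hpos]
    ring
  have hcoef : ∀ (k₁ k₂ : ℤ) (d : ℝ),
      lam ^ ((n : ℝ) - d) * lam ^ (-((1 / 5 : ℝ) * ((n + k₁ : ℤ) : ℝ))) *
          lam ^ (-((1 / 5 : ℝ) * ((n + k₂ : ℤ) : ℝ))) =
        lam ^ (-((1 / 5 : ℝ) * n)) * lam ^ ((4 / 5 : ℝ) * n) *
          lam ^ (-(d + ((k₁ : ℝ) + (k₂ : ℝ)) / 5)) := by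
    intro k₁ k₂ d
    push_cast
    simp only [← Real.rpow_add hpos]
    congr 1
    ring
  have hterm : ∀ (i₁ i₂ : Fin m) (μ : Option (Fin 3)),
      coeff i₁ i₂ i μ * lam ^ ((n : ℝ) - (if μ = some 2 then 1 else 0)) *
          profX lam ψ i₁ (n + ((if μ = some 0 then 1 else 0) - (if μ = some 2 then 1 else 0))) t *
          profX lam ψ i₂ (n + ((if μ = some 1 then 1 else 0) - (if μ = some 2 then 1 else 0))) t =
        lam ^ (-((1 / 5 : ℝ) * n)) * lam ^ ((4 / 5 : ℝ) * n) *
          (coeff i₁ i₂ i μ * (1 : ℝ) * lam ^ (-(drop μ + ((off₁ μ : ℝ) + (off₂ μ : ℝ)) / 5)) *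
            ψ i₁ (lam ^ ((4 / 5 : ℝ) * (off₁ μ : ℝ)) * r) *
            ψ i₂ (lam ^ ((4 / 5 : ℝ) * (off₂ μ : ℝ)) * r)) := by
    intro i₁ i₂ μ
    have e1 : ((if μ = some 0 then 1 else 0) - (if μ = some 2 then 1 else 0) : ℤ) = off₁ μ := rfl
    have e2 : ((if μ = some 1 then 1 else 0) - (if μ = some 2 then 1 else 0) : ℤ) = off₂ μ := rfl
    have e3 : ((if μ = some 2 then 1 else 0) : ℝ) = drop μ := rfl
    rw [e1, e2, e3]
    simp only [profX]
    rw [harg (off₁ μ), harg (off₂ μ)]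
    have := hcoef (off₁ μ) (off₂ μ) (drop μ)
    calc coeff i₁ i₂ i μ * lam ^ ((n : ℝ) - drop μ) *
          (lam ^ (-((1 / 5 : ℝ) * ((n + off₁ μ : ℤ) : ℝ))) * ψ i₁ (lam ^ ((4 / 5 : ℝ) * (off₁ μ : ℝ)) * r)) *
          (lam ^ (-((1 / 5 : ℝ) * ((n + off₂ μ : ℤ) : ℝ))) * ψ i₂ (lam ^ ((4 / 5 : ℝ) * (off₂ μ : ℝ)) * r))
        = (lam ^ ((n : ℝ) - drop μ) * lam ^ (-((1 / 5 : ℝ) * ((n + off₁ μ : ℤ) : ℝ))) *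
            lam ^ (-((1 / 5 : ℝ) * ((n + off₂ μ : ℤ) : ℝ)))) *
            (coeff i₁ i₂ i μ * ψ i₁ (lam ^ ((4 / 5 : ℝ) * (off₁ μ : ℝ)) * r) *
              ψ i₂ (lam ^ ((4 / 5 : ℝ) * (off₂ μ : ℝ)) * r)) := by ring
      _ = _ := by rw [this]; ring
  have hsum :
      (∑ i₁ : Fin m, ∑ i₂ : Fin m, ∑ μ : Option (Fin 3),
          coeff i₁ i₂ i μ * lam ^ ((n : ℝ) - (if μ = some 2 then 1 else 0)) *
            profX lam ψ i₁ (n + ((if μ = some 0 then 1 else 0) - (if μ = some 2 then 1 else 0))) t *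
            profX lam ψ i₂ (n + ((if μ = some 1 then 1 else 0) - (if μ = some 2 then 1 else 0))) t) =
        lam ^ (-((1 / 5 : ℝ) * n)) * lam ^ ((4 / 5 : ℝ) * n) *
          profileN lam coeff (fun _ => (1 : ℝ)) ψ i r := by
    simp only [profileN, Finset.mul_sum]
    refine Finset.sum_congr rfl fun i₁ _ => Finset.sum_congr rfl fun i₂ _ =>
      Finset.sum_congr rfl fun μ _ => ?_
    exact hterm i₁ i₂ μ
  rw [hsum]
  have hXr : profX lam ψ i n t = lam ^ (-((1 / 5 : ℝ) * n)) * ψ i r := by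
    simp only [profX, hr]
  rw [hXr]
  ring

end Transfer

/-! ## Composition (kernel-checked, sorry-free): the five statements prove the crux -/

/-- **Composition (the real proof).** `S1 → S2 → S3 → S4 → ⟨the crux statement, verbatim⟩` (stated UNFOLDED so
that the by-name theorem `CircuitPump_of` below is the unique `#h21_check_skeleton` candidate; the first
tactic is `show CircuitPump`): for `lam₀ > 1`, S4 supplies Tao
data `(ε₀, K, ε)`, the gate radius `r₂`, the tube `Ω` and the clocked profile `φ₀`; S2 makes the declocking
homotopy `H σ = σT₁ + (1−σ)T_{gate}` continuous and compact on `[0,1] × cl Ω` and gives the compact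
derivative of `T_{gate}` at `φ₀`; S3 (Leray–Schauder) then produces a fixed point `φ₁ ∈ Ω` of `T₁`, nonzero
because `0 ∉ cl Ω`; S1 turns it into a `C¹` profile solution on `(0,∞)`, with the weight bound
(`sqrt_mul_abs_unweight_le`) and nontriviality (`exists_unweight_ne_zero_of_fixedPoint`) proved here; the
PROVED transfer (`profX_hasDerivAt`, `profX_dss`, `profX_typeI`) turns that into an exactly `1`-DSS, Type-I,
nontrivial ancient solution of Tao's autonomous 4-mode circuit (Table 1 constants re-encoded:
`taoCoeffOpt_symm`, `taoCoeffOpt_cyclic`) with `lam = (1+ε₀)^{5/2} ∈ (1, lam₀)`, `m = 4`, `k = 1`. -/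
theorem circuitPump_of_parts (hF : FixedPointIsProfile) (hC : CompleteContinuity)
    (hLS : LeraySchauderContinuation) (hB : DeclockingBox) :
    ∀ lam₀ : ℝ, 1 < lam₀ → ∃ lam : ℝ, 1 < lam ∧ lam < lam₀ ∧
      ∃ (m : ℕ) (coeff : Fin m → Fin m → Fin m → Option (Fin 3) → ℝ) (k : ℕ) (X : Fin m → ℤ → ℝ → ℝ),
        let F : Fin m → ℤ → ℝ → ℝ := fun (i : Fin m) (n : ℤ) (t : ℝ) =>
          -(lam ^ ((4 / 5 : ℝ) * n)) * X i n t +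
            ∑ i₁ : Fin m, ∑ i₂ : Fin m, ∑ μ : Option (Fin 3),
              coeff i₁ i₂ i μ * lam ^ ((n : ℝ) - (if μ = some 2 then 1 else 0)) *
                X i₁ (n + ((if μ = some 0 then 1 else 0) - (if μ = some 2 then 1 else 0))) t *
                X i₂ (n + ((if μ = some 1 then 1 else 0) - (if μ = some 2 then 1 else 0))) t;
        (∀ (i₁ i₂ i₃ : Fin m) (μ : Option (Fin 3)),
            coeff i₁ i₂ i₃ μ = coeff i₂ i₁ i₃ (Option.map (Equiv.swap (0 : Fin 3) 1) μ)) ∧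
          (∀ (v : Fin 3 → Fin m) (μ : Option (Fin 3)),
              ∑ σ : Equiv.Perm (Fin 3), coeff (v (σ 0)) (v (σ 1)) (v (σ 2)) (Option.map σ.symm μ) = 0) ∧
          1 ≤ k ∧
          (∀ (i : Fin m) (n : ℤ) (t : ℝ), t < 0 → HasDerivAt (X i n) (F i n t) t) ∧
          (∀ (i : Fin m) (n : ℤ) (t : ℝ), t < 0 →
              X i (n + k) (lam ^ (-((4 / 5 : ℝ) * k)) * t) = lam ^ (-((1 / 5 : ℝ) * k)) * X i n t) ∧
          (∃ C : ℝ, ∀ (i : Fin m) (n : ℤ) (t : ℝ), t < 0 →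
              lam ^ ((3 / 5 : ℝ) * n) * |X i n t| ≤ C / Real.sqrt (-t)) ∧
          (∃ (i : Fin m) (n : ℤ) (t : ℝ), t < 0 ∧ X i n t ≠ 0) := by
  show Theses.PerpetualPump.CircuitPump
  intro lam₀ hlam₀
  obtain ⟨ε₀, K, ε, r₂, hε₀, hlt, hr₂, Ω, φ₀, hΩo, hΩb, h0, hφ₀, hfix, huniq, hnondeg, hbdry⟩ :=
    hB lam₀ hlam₀
  have hlam : 1 < taoLam ε₀ := one_lt_taoLam hε₀
  -- S3 for the two gatings
  obtain ⟨-, hcont1, hcomp1, -⟩ := hC (taoLam ε₀) hlam 4 (taoCoeffOpt ε₀ K ε) (fun _ => (1 : ℝ))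
    measurable_const (fun _ => ⟨zero_le_one, le_rfl⟩)
  obtain ⟨-, hcont0, hcomp0, hderiv0⟩ := hC (taoLam ε₀) hlam 4 (taoCoeffOpt ε₀ K ε) (gate r₂)
    (measurable_gate r₂) (gate_mem_Icc r₂)
  obtain ⟨L, hL, hLc⟩ := hderiv0 φ₀
  -- the homotopy and its ends
  set H : ℝ → E 4 → E 4 := homotopyH (taoLam ε₀) (taoCoeffOpt ε₀ K ε) r₂ with hH
  have hH0 : H 0 = opT (taoLam ε₀) (taoCoeffOpt ε₀ K ε) (gate r₂) := by
    funext φ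
    simp [hH, homotopyH]
    exact zero_smul ℝ (_ : E 4)
  have hH1 : ∀ φ, H 1 φ = opT (taoLam ε₀) (taoCoeffOpt ε₀ K ε) (fun _ => (1 : ℝ)) φ := by
    intro φ
    simp [hH, homotopyH]
    exact zero_smul ℝ (_ : E 4)
  -- joint continuity
  have hHcont : Continuous fun p : ℝ × E 4 => H p.1 p.2 := by
    simp only [hH, homotopyH]
    exact (continuous_fst.smul (hcont1.comp continuous_snd)).add
      ((continuous_const.sub continuous_fst).smul (hcont0.comp continuous_snd))
  -- compactness of the homotopy on `[0,1] × cl Ω`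
  have hHK : IsCompact (closure ((fun p : ℝ × E 4 => H p.1 p.2) '' (Set.Icc (0 : ℝ) 1 ×ˢ closure Ω))) := by
    have hb : Bornology.IsBounded (closure Ω) := hΩb.closure
    have K1 := hcomp1 _ hb
    have K0 := hcomp0 _ hb
    set g : ℝ × (E 4 × E 4) → E 4 := fun q => q.1 • q.2.1 + (1 - q.1) • q.2.2 with hg
    have hgc : Continuous g :=
      (continuous_fst.smul (continuous_fst.comp continuous_snd)).add
        ((continuous_const.sub continuous_fst).smul (continuous_snd.comp continuous_snd))
    have hKc : IsCompact (g '' (Set.Icc (0 : ℝ) 1 ×ˢ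
        (closure (opT (taoLam ε₀) (taoCoeffOpt ε₀ K ε) (fun _ => (1 : ℝ)) '' closure Ω) ×ˢ
          closure (opT (taoLam ε₀) (taoCoeffOpt ε₀ K ε) (gate r₂) '' closure Ω)))) :=
      (isCompact_Icc.prod (K1.prod K0)).image hgc
    refine hKc.of_isClosed_subset isClosed_closure (closure_minimal ?_ hKc.isClosed)
    rintro _ ⟨⟨σ, φ⟩, ⟨hσ, hφ⟩, rfl⟩
    refine ⟨(σ, (opT (taoLam ε₀) (taoCoeffOpt ε₀ K ε) (fun _ => (1 : ℝ)) φ,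
      opT (taoLam ε₀) (taoCoeffOpt ε₀ K ε) (gate r₂) φ)),
      ⟨hσ, subset_closure ⟨φ, hφ, rfl⟩, subset_closure ⟨φ, hφ, rfl⟩⟩, ?_⟩
    simp [hg, hH, homotopyH]
  -- Leray–Schauder
  have hderivH : HasFDerivAt (H 0) L φ₀ := by rw [hH0]; exact hL
  have hfixH : H 0 φ₀ = φ₀ := by rw [hH0]; exact hfix
  have huniqH : ∀ x ∈ closure Ω, H 0 x = x → x = φ₀ := by rw [hH0]; exact huniq
  have hbdryH : ∀ σ ∈ Set.Icc (0 : ℝ) 1, ∀ x ∈ frontier Ω, H σ x ≠ x := hbdry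
  obtain ⟨φ₁, hφ₁Ω, hφ₁⟩ := hLS (E 4) Ω H φ₀ L hΩo hΩb hHcont.continuousOn hHK hbdryH hφ₀ hfixH
    huniqH hderivH hLc (hnondeg L hL)
  rw [hH1] at hφ₁
  -- the autonomous fixed point is a nontrivial Type-I profile
  have hne : φ₁ ≠ 0 := fun h => h0 (h ▸ subset_closure hφ₁Ω)
  have hode := hF (taoLam ε₀) hlam 4 (taoCoeffOpt ε₀ K ε) φ₁ hφ₁
  have hbd : ∃ C : ℝ, ∀ (i : Fin 4) (r : ℝ), 0 < r → Real.sqrt r * |unweight φ₁ i r| ≤ C :=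
    ⟨‖φ₁‖, fun i r hr => sqrt_mul_abs_unweight_le φ₁ i r hr⟩
  have hnt := exists_unweight_ne_zero_of_fixedPoint (taoLam ε₀) (taoCoeffOpt ε₀ K ε) _ φ₁ hφ₁ hne
  obtain ⟨C, hC'⟩ := hbd
  -- the crux witness: lam, m = 4, Tao's constants, period k = 1, X = profX from the profile
  refine ⟨taoLam ε₀, hlam, hlt, 4, taoCoeffOpt ε₀ K ε, 1, profX (taoLam ε₀) (unweight φ₁), ?_⟩
  intro F
  refine ⟨taoCoeffOpt_symm ε₀ K ε, taoCoeffOpt_cyclic ε₀ K ε, le_rfl,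
    fun i n t ht => profX_hasDerivAt hlam (taoCoeffOpt ε₀ K ε) (unweight φ₁) hode i n t ht, ?_,
    ⟨C, fun i n t ht => profX_typeI hlam (unweight φ₁) hC' i n t ht⟩, ?_⟩
  · intro i n t ht
    have := profX_dss hlam (unweight φ₁) i n t
    simpa using this
  · obtain ⟨i, r, hr, hψ⟩ := hnt
    refine ⟨i, 0, -r, by linarith, ?_⟩
    simpa [profX] using hψ

/-- **The skeleton concludes the crux BY NAME** (the `#h21_check_skeleton` theorem): the four registered
stubs, fed to the sorry-free `circuitPump_of_parts`, give
`Summit.NavierStokesRegularity.NavierStokesRegularity.Theses.PerpetualPump.CircuitPump`. No `sorry` of its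
own; its axiom closure contains `sorryAx` exactly through the four `stub_*` (closed once they land). -/
theorem CircuitPump_of : Theses.PerpetualPump.CircuitPump :=
  circuitPump_of_parts stub_fixedPointIsProfile stub_completeContinuity stub_lerayschauder
    stub_declockingBox

end Summit.NavierStokesRegularity.NavierStokesRegularity.Cruxes.CircuitPump.DeclockingContinuation
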